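import Literature.Probability.LatticeModels.ImprovedTreeDiagramBoundProofs
import Literature.Probability.LatticeModels.AnnularCovering
import HarnessLib

/-!
# The dynamical scale sequence of Aizenman–Duminil-Copin 2021, §6.1 (`ℓ_{k+1} = inf{ℓ : B_ℓ ≥ D B_{ℓ_k}}`)

Topic `Literature/Probability/LatticeModels`. The unconditional proof of the improved tree diagram
bound (the tree's named fact `aizenmanDuminilCopin_improvedTreeDiagramBound`,
`ImprovedTreeDiagramBound.lean`) chooses its length scales dynamically from the bubble diagram
`B_L(β) = ∑_{x ∈ Λ_L} ⟨σ₀σ_x⟩²_β` (M. Aizenman, H. Duminil-Copin, Ann. of Math. **194** (2021),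
arXiv:1912.07973, §6.1, first display, p. 21):

  "Fix `D ≫ 1` and define recursively a (possibly finite) sequence `𝓛` of integers
  `ℓ_k = ℓ_k(β, D)` by the formula `ℓ_0 = 0` and `ℓ_{k+1} = inf{ℓ : B_ℓ(β) ≥ D B_{ℓ_k}(β)}`.
  By the Infrared Bound (5.1), `B_L - B_ℓ ≤ C₀ log(L/ℓ)` (in dimension `d = 4`) from which it is
  a simple exercise to deduce that under the above definition `D^k ≤ B_{ℓ_k}(β) ≤ C D^k` for every
  `k` and some large constant `C` independent of `k`."

and, in the proof of Theorem 1.3 (ibid., p. 21): "since `B_{ℓ_k}(β) ≤ C D^k`, we may choose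
`K ≥ c log B_L(β)` with `2ℓ_K ≤ L`, where `c` is independent of `L` and `β`". This file does the
"simple exercise" once and for all, for an arbitrary non-decreasing `B : ℕ → ℝ` with `B 0 > 0`:

* `bubbleScale B D k` — the sequence (`ℓ_0 = 0`; the infimum over the empty set is rendered by
  freezing the sequence, `ℓ_{k+1} = ℓ_k`, and `BubbleScaleAlive B D k` records that the first `k`
  infima were over non-empty sets, i.e. that `ℓ_0, …, ℓ_k` is an initial segment of the printed
  possibly finite sequence);
* the defining properties `D B_{ℓ_k} ≤ B_{ℓ_{k+1}}` (`le_apply_bubbleScale_succ`) and minimality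
  (`apply_lt_of_lt_bubbleScale_succ`: `m < ℓ_{k+1} ⇒ B_m < D B_{ℓ_k}`; conversely
  `lt_bubbleScale_succ_of_apply_lt`: `B_m < D B_{ℓ_k} ⇒ m < ℓ_{k+1}`, the form in which growth
  statements "`ℓ_{k+1} ≥ 2ℓ_k`", "`ℓ_{k+1} ≥ ℓ_k^α`" are obtained from shell bounds on `B`);
* **the lower bound** `D^k B_0 ≤ B_{ℓ_k}` (`pow_mul_le_apply_bubbleScale`) and **the upper bound**
  `B_{ℓ_k} ≤ (B_0 + C₀/(D-1)) D^k` from a one-step bound `B_{n+1} ≤ B_n + C₀`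
  (`apply_bubbleScale_le`), i.e. the display `D^k ≤ B_{ℓ_k} ≤ C D^k`;
* strict growth `ℓ_k < ℓ_{k+1}` (`bubbleScale_lt_succ`, `bubbleScale_strictMono_of_alive`,
  `le_bubbleScale_self`) and doubling `2ℓ_k < ℓ_{k+1}` from a dyadic shell bound `B_{2n} ≤ B_n + C₁`
  with `C₁ < (D-1) B_0` (`two_mul_bubbleScale_lt_succ`) — the hypotheses `1 ≤ ℓ_1`,
  `2ℓ_k ≤ ℓ_{k+1}` of the annular covering lemma (`AnnularCovering.lean`), reached for all indices
  through the doubling extension `doublingExt ℓ K` of the alive initial segment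
  (`two_mul_doublingExt_le`, `one_le_doublingExt_one`, `annulusCount_doublingExt`);
* **the choice of `K`** (`exists_bubbleScaleAlive_le_and_lt`): for every `N` there is an alive
  index `K` with `ℓ_K ≤ N` and `B_N < D B_{ℓ_K}`, whence `B_N < (B_0 + C₀/(D-1)) D^{K+1}`
  (`exists_bubbleScaleAlive_le_and_lt_pow`) — with `N = ⌊L/2⌋` this is "`K ≥ c log B_L` with
  `2ℓ_K ≤ L`";
* the instance for the bubble diagram on `ℤ⁴` (`bubbleDiagram S n`, `ImprovedTreeDiagramBound.lean`)
  of a function `0 ≤ S ≤ A/‖x‖²_∞` off the origin with `S(0) = 1` (the infrared bound in `x`-space,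
  ADC (5.1)/(5.23)): `B_0 = 1`, monotonicity, the one-step bound `B_{n+1} ≤ B_n + 216 A²` and the
  dyadic bound `B_{2n} ≤ B_n + 216 A²` (`bubbleDiagram_succ_le_add`, `bubbleDiagram_two_mul_le_add`),
  so that all of the above applies with `C₀ = C₁ = 216 A²` and any `D > 1 + 216 A²`
  (`bubbleDiagram_scales`).

Everything is proved; no named fact is introduced. The intersection-clustering bound (Prop. 6.1),
which is what these scales are for, is not touched here.

## References

* M. Aizenman, H. Duminil-Copin, *Marginal triviality of the scaling limits of critical 4D Ising and
  `φ⁴₄` models*, Ann. of Math. 194 (2021), arXiv:1912.07973, §6.1 (definition of `𝓛`, the display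
  `D^k ≤ B_{ℓ_k} ≤ CD^k`, proof of Thm 1.3) [AizenmanDuminilCopinAnnals2021].

## Mathlib

`Nat.find`, `Nat.find_spec`, `Nat.find_min`, `Nat.findGreatest_spec`, `Nat.le_findGreatest`,
`Finset.sum_range_succ`, `geom`-type inductions by hand.
-/

noncomputable section

open Finset

namespace Literature.Probability.LatticeModels

/-! ### Part 1. The scale sequence of a non-decreasing function -/

section Abstract

variable {B : ℕ → ℝ} {D : ℝ}

open scoped Classical in
/-- **The dynamical scale sequence** `ℓ_0 = 0`, `ℓ_{k+1} = inf{ℓ : B_ℓ ≥ D B_{ℓ_k}}` of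
Aizenman–Duminil-Copin 2021, §6.1, for a function `B : ℕ → ℝ` and `D ∈ ℝ`; when the infimum is
over the empty set (the printed "possibly finite" sequence has ended) the sequence is frozen,
`ℓ_{k+1} = ℓ_k`. [cite: AizenmanDuminilCopinAnnals2021, arXiv:1912.07973 §6.1, first display (p. 21)] -/
def bubbleScale (B : ℕ → ℝ) (D : ℝ) : ℕ → ℕ
  | 0 => 0
  | k + 1 => if h : ∃ n, D * B (bubbleScale B D k) ≤ B n then Nat.find h else bubbleScale B D k

/-- The recursion is **alive** up to index `k`: each of the infima defining `ℓ_1, …, ℓ_k` was over a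
non-empty set, so that `ℓ_0, …, ℓ_k` is an initial segment of the printed (possibly finite)
sequence. [cite: AizenmanDuminilCopinAnnals2021, arXiv:1912.07973 §6.1, "(possibly finite) sequence 𝓛" (p. 21)] -/
def BubbleScaleAlive (B : ℕ → ℝ) (D : ℝ) (k : ℕ) : Prop :=
  ∀ j < k, ∃ n, D * B (bubbleScale B D j) ≤ B n

/-- `ℓ_0 = 0`. [cite: AizenmanDuminilCopinAnnals2021, arXiv:1912.07973 §6.1 (p. 21)] -/
@[simp] theorem bubbleScale_zero : bubbleScale B D 0 = 0 := rfl

/-- The frozen case: `ℓ_{k+1} = ℓ_k` when no `ℓ` has `B_ℓ ≥ D B_{ℓ_k}`. [folklore] -/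
theorem bubbleScale_succ_of_not {k : ℕ} (h : ¬ ∃ n, D * B (bubbleScale B D k) ≤ B n) :
    bubbleScale B D (k + 1) = bubbleScale B D k := by
  rw [bubbleScale, dif_neg h]

/-- The defining inequality `D B_{ℓ_k} ≤ B_{ℓ_{k+1}}` (when the infimum is over a non-empty set).
[cite: AizenmanDuminilCopinAnnals2021, arXiv:1912.07973 §6.1, first display (p. 21)] -/
theorem le_apply_bubbleScale_succ {k : ℕ} (h : ∃ n, D * B (bubbleScale B D k) ≤ B n) :
    D * B (bubbleScale B D k) ≤ B (bubbleScale B D (k + 1)) := by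
  classical
  rw [bubbleScale, dif_pos h]
  convert Nat.find_spec h

/-- Minimality of `ℓ_{k+1}`: every `m < ℓ_{k+1}` has `B_m < D B_{ℓ_k}`.
[cite: AizenmanDuminilCopinAnnals2021, arXiv:1912.07973 §6.1, first display (p. 21)] -/
theorem apply_lt_of_lt_bubbleScale_succ {k : ℕ} (h : ∃ n, D * B (bubbleScale B D k) ≤ B n) {m : ℕ}
    (hm : m < bubbleScale B D (k + 1)) : B m < D * B (bubbleScale B D k) := by
  classical
  rw [bubbleScale, dif_pos h] at hm
  exact not_le.1 (Nat.find_min h (by convert hm))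

/-- **Growth from a bound on `B`**: if `B` is non-decreasing and `B_m < D B_{ℓ_k}` then
`m < ℓ_{k+1}` — the form in which "`ℓ_{k+1} ≥ 2ℓ_k`" (from `B_{2ℓ} - B_ℓ ≤ C₁`) and
"`ℓ_{k+1} ≥ ℓ_k^α`" (from Lemma 6.3) are read off. [cite: AizenmanDuminilCopinAnnals2021, arXiv:1912.07973 §6.1 (p. 21) and proof of Prop. 6.1 ("we may choose D = D(α) such that ℓ_{k+1} ≥ ℓ_k^α", p. 22)] -/
theorem lt_bubbleScale_succ_of_apply_lt (hB : Monotone B) {k : ℕ}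
    (h : ∃ n, D * B (bubbleScale B D k) ≤ B n) {m : ℕ} (hm : B m < D * B (bubbleScale B D k)) :
    m < bubbleScale B D (k + 1) := by
  by_contra hle
  have h1 : B (bubbleScale B D (k + 1)) ≤ B m := hB (not_lt.1 hle)
  have h2 := le_apply_bubbleScale_succ h
  linarith

/-! #### The alive predicate -/

/-- Index `0` is alive. [folklore] -/
theorem bubbleScaleAlive_zero : BubbleScaleAlive B D 0 := fun j hj => absurd hj (Nat.not_lt_zero j)

/-- `k+1` is alive iff `k` is alive and the `(k+1)`-st infimum is over a non-empty set. [folklore] -/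
theorem bubbleScaleAlive_succ_iff {k : ℕ} :
    BubbleScaleAlive B D (k + 1) ↔ BubbleScaleAlive B D k ∧ ∃ n, D * B (bubbleScale B D k) ≤ B n := by
  constructor
  · intro h
    exact ⟨fun j hj => h j (Nat.lt_succ_of_lt hj), h k (Nat.lt_succ_self k)⟩
  · rintro ⟨h1, h2⟩ j hj
    rcases Nat.lt_succ_iff_lt_or_eq.1 hj with hj | rfl
    · exact h1 j hj
    · exact h2

/-- Aliveness is inherited by smaller indices. [folklore] -/
theorem BubbleScaleAlive.mono {j k : ℕ} (h : BubbleScaleAlive B D k) (hjk : j ≤ k) :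
    BubbleScaleAlive B D j := fun i hi => h i (lt_of_lt_of_le hi hjk)

/-- A non-decreasing `B` with `B_0 > 0` is positive. [folklore] -/
theorem apply_pos_of_monotone (hB : Monotone B) (hB0 : 0 < B 0) (n : ℕ) : 0 < B n :=
  lt_of_lt_of_le hB0 (hB (Nat.zero_le n))

/-! #### The lower bound `D^k ≤ B_{ℓ_k}` -/

/-- **Lower bound** (Aizenman–Duminil-Copin 2021, §6.1, "`D^k ≤ B_{ℓ_k}`"): `D^k B_0 ≤ B_{ℓ_k}` for
every alive `k` (`D ≥ 0`). [cite: AizenmanDuminilCopinAnnals2021, arXiv:1912.07973 §6.1, display D^k ≤ B_{ℓ_k} ≤ CD^k (p. 21)] -/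
theorem pow_mul_le_apply_bubbleScale (hD : 0 ≤ D) {k : ℕ} (h : BubbleScaleAlive B D k) :
    D ^ k * B 0 ≤ B (bubbleScale B D k) := by
  induction k with
  | zero => simp
  | succ k ih =>
    obtain ⟨hk, hex⟩ := bubbleScaleAlive_succ_iff.1 h
    calc D ^ (k + 1) * B 0 = D * (D ^ k * B 0) := by ring
      _ ≤ D * B (bubbleScale B D k) := mul_le_mul_of_nonneg_left (ih hk) hD
      _ ≤ B (bubbleScale B D (k + 1)) := le_apply_bubbleScale_succ hex

/-! #### Strict growth -/

/-- `ℓ_k < ℓ_{k+1}` at an alive step (`B` non-decreasing and positive, `D > 1`). [folklore] -/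
theorem bubbleScale_lt_succ (hB : Monotone B) (hB0 : 0 < B 0) (hD : 1 < D) {k : ℕ}
    (hex : ∃ n, D * B (bubbleScale B D k) ≤ B n) : bubbleScale B D k < bubbleScale B D (k + 1) :=
  lt_bubbleScale_succ_of_apply_lt hB hex
    (lt_mul_left (apply_pos_of_monotone hB hB0 _) hD)

/-- `ℓ` is non-decreasing (always). [folklore] -/
theorem bubbleScale_monotone (hB : Monotone B) (hB0 : 0 < B 0) (hD : 1 < D) :
    Monotone (bubbleScale B D) := by
  refine monotone_nat_of_le_succ fun k => ?_
  by_cases hex : ∃ n, D * B (bubbleScale B D k) ≤ B n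
  · exact (bubbleScale_lt_succ hB hB0 hD hex).le
  · rw [bubbleScale_succ_of_not hex]

/-- **Strict growth on an alive initial segment**: `ℓ_i < ℓ_j` for `i < j ≤ k`, `k` alive.
[cite: AizenmanDuminilCopinAnnals2021, arXiv:1912.07973 §6.1 ("increasing sequence of lengths", §4.1) (p. 10, 21)] -/
theorem bubbleScale_strictMono_of_alive (hB : Monotone B) (hB0 : 0 < B 0) (hD : 1 < D) {k : ℕ}
    (h : BubbleScaleAlive B D k) {i j : ℕ} (hij : i < j) (hjk : j ≤ k) :
    bubbleScale B D i < bubbleScale B D j := by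
  have hstep : bubbleScale B D i < bubbleScale B D (i + 1) :=
    bubbleScale_lt_succ hB hB0 hD (h i (lt_of_lt_of_le hij hjk))
  exact lt_of_lt_of_le hstep (bubbleScale_monotone hB hB0 hD hij)

/-- `k ≤ ℓ_k` for alive `k`. [folklore] -/
theorem le_bubbleScale_self (hB : Monotone B) (hB0 : 0 < B 0) (hD : 1 < D) {k : ℕ}
    (h : BubbleScaleAlive B D k) : k ≤ bubbleScale B D k := by
  induction k with
  | zero => simp
  | succ k ih =>
    obtain ⟨hk, hex⟩ := bubbleScaleAlive_succ_iff.1 h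
    exact Nat.succ_le_of_lt (lt_of_le_of_lt (ih hk) (bubbleScale_lt_succ hB hB0 hD hex))

/-- `ℓ_{k+1} ≥ 1` at an alive step. [folklore] -/
theorem one_le_bubbleScale_succ (hB : Monotone B) (hB0 : 0 < B 0) (hD : 1 < D) {k : ℕ}
    (hex : ∃ n, D * B (bubbleScale B D k) ≤ B n) : 1 ≤ bubbleScale B D (k + 1) :=
  Nat.succ_le_of_lt (lt_of_le_of_lt (Nat.zero_le _) (bubbleScale_lt_succ hB hB0 hD hex))

/-! #### The upper bound `B_{ℓ_k} ≤ C D^k` from a one-step bound -/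

/-- A one-step bound `B_{n+1} ≤ B_n + C₀` for a non-decreasing `B` forces `C₀ ≥ 0`. [folklore] -/
theorem nonneg_of_step (hB : Monotone B) {C₀ : ℝ} (hstep : ∀ n, B (n + 1) ≤ B n + C₀) : 0 ≤ C₀ := by
  have h1 := hstep 0
  have h2 : B 0 ≤ B 1 := hB (Nat.zero_le 1)
  linarith

/-- **One step of the upper bound**: `B_{ℓ_{k+1}} ≤ D B_{ℓ_k} + C₀` — at an alive step
`ℓ_{k+1} - 1` violates the defining inequality and one more shell costs at most `C₀`; at a frozen
step the left side is `B_{ℓ_k}`. [cite: AizenmanDuminilCopinAnnals2021, arXiv:1912.07973 §6.1, "a simple exercise" (p. 21)] -/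
theorem apply_bubbleScale_succ_le (hB : Monotone B) (hB0 : 0 < B 0) (hD : 1 < D) {C₀ : ℝ}
    (hstep : ∀ n, B (n + 1) ≤ B n + C₀) (k : ℕ) :
    B (bubbleScale B D (k + 1)) ≤ D * B (bubbleScale B D k) + C₀ := by
  have hC₀ := nonneg_of_step hB hstep
  by_cases hex : ∃ n, D * B (bubbleScale B D k) ≤ B n
  · have h1 : bubbleScale B D (k + 1) ≠ 0 := by
      have := one_le_bubbleScale_succ hB hB0 hD hex
      omega
    obtain ⟨p, hp⟩ := Nat.exists_eq_succ_of_ne_zero h1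
    have hlt : B p < D * B (bubbleScale B D k) :=
      apply_lt_of_lt_bubbleScale_succ hex (by omega)
    calc B (bubbleScale B D (k + 1)) = B (p + 1) := by rw [hp]
      _ ≤ B p + C₀ := hstep p
      _ ≤ D * B (bubbleScale B D k) + C₀ := by linarith
  · rw [bubbleScale_succ_of_not hex]
    have hpos := apply_pos_of_monotone hB hB0 (bubbleScale B D k)
    nlinarith

/-- **Upper bound, sharp form**: `B_{ℓ_k} ≤ (B_0 + C₀/(D-1)) D^k - C₀/(D-1)` for every `k`.
[cite: AizenmanDuminilCopinAnnals2021, arXiv:1912.07973 §6.1, display D^k ≤ B_{ℓ_k} ≤ CD^k (p. 21)] -/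
theorem apply_bubbleScale_le_sub (hB : Monotone B) (hB0 : 0 < B 0) (hD : 1 < D) {C₀ : ℝ}
    (hstep : ∀ n, B (n + 1) ≤ B n + C₀) (k : ℕ) :
    B (bubbleScale B D k) ≤ (B 0 + C₀ / (D - 1)) * D ^ k - C₀ / (D - 1) := by
  induction k with
  | zero => simp
  | succ k ih =>
    have hD1 : (0 : ℝ) < D - 1 := by linarith
    have hkey : D * (C₀ / (D - 1)) = C₀ / (D - 1) + C₀ := by
      field_simp
      ring
    calc B (bubbleScale B D (k + 1)) ≤ D * B (bubbleScale B D k) + C₀ :=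
          apply_bubbleScale_succ_le hB hB0 hD hstep k
      _ ≤ D * ((B 0 + C₀ / (D - 1)) * D ^ k - C₀ / (D - 1)) + C₀ :=
          add_le_add (mul_le_mul_of_nonneg_left ih (le_of_lt (lt_trans zero_lt_one hD))) le_rfl
      _ = (B 0 + C₀ / (D - 1)) * D ^ (k + 1) - C₀ / (D - 1) := by
          rw [mul_sub, hkey]; ring

/-- **Upper bound** (Aizenman–Duminil-Copin 2021, §6.1, "`B_{ℓ_k} ≤ C D^k` for every `k` and some
large constant `C` independent of `k`"), with `C = B_0 + C₀/(D-1)` from the one-step bound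
`B_{n+1} ≤ B_n + C₀`. [cite: AizenmanDuminilCopinAnnals2021, arXiv:1912.07973 §6.1, display D^k ≤ B_{ℓ_k} ≤ CD^k (p. 21)] -/
theorem apply_bubbleScale_le (hB : Monotone B) (hB0 : 0 < B 0) (hD : 1 < D) {C₀ : ℝ}
    (hstep : ∀ n, B (n + 1) ≤ B n + C₀) (k : ℕ) :
    B (bubbleScale B D k) ≤ (B 0 + C₀ / (D - 1)) * D ^ k := by
  have h := apply_bubbleScale_le_sub hB hB0 hD hstep k
  have hC₀ := nonneg_of_step hB hstep
  have : 0 ≤ C₀ / (D - 1) := div_nonneg hC₀ (by linarith)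
  linarith

/-! #### Doubling -/

/-- **Doubling of the scales**: if `B_{2n} ≤ B_n + C₁` for all `n` and `C₁ < (D-1) B_{ℓ_k}` then
`2ℓ_k < ℓ_{k+1}` at an alive step (so `ℓ_{k+1} ≥ 2ℓ_k`, the hypothesis of the covering Lemma 4.2).
[cite: AizenmanDuminilCopinAnnals2021, arXiv:1912.07973 Lemma 4.2 hypothesis ℓ_{k+1} ≥ 2ℓ_k (p. 10) with §6.1 (p. 21)] -/
theorem two_mul_bubbleScale_lt_succ (hB : Monotone B) {C₁ : ℝ} (hshell : ∀ n, B (2 * n) ≤ B n + C₁)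
    {k : ℕ} (hC : C₁ < (D - 1) * B (bubbleScale B D k))
    (hex : ∃ n, D * B (bubbleScale B D k) ≤ B n) :
    2 * bubbleScale B D k < bubbleScale B D (k + 1) :=
  lt_bubbleScale_succ_of_apply_lt hB hex (by have := hshell (bubbleScale B D k); nlinarith)

/-- Doubling along an alive initial segment from `C₁ < (D-1) B_0`: `2ℓ_j < ℓ_{j+1}` for `j < k`.
[cite: AizenmanDuminilCopinAnnals2021, arXiv:1912.07973 Lemma 4.2 hypothesis (p. 10) with §6.1 (p. 21)] -/
theorem two_mul_bubbleScale_lt_succ_of_alive (hB : Monotone B) (hD : 1 < D) {C₁ : ℝ}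
    (hshell : ∀ n, B (2 * n) ≤ B n + C₁) (hC : C₁ < (D - 1) * B 0) {k : ℕ}
    (h : BubbleScaleAlive B D k) {j : ℕ} (hj : j < k) :
    2 * bubbleScale B D j < bubbleScale B D (j + 1) := by
  refine two_mul_bubbleScale_lt_succ hB hshell (lt_of_lt_of_le hC ?_) (h j hj)
  exact mul_le_mul_of_nonneg_left (hB (Nat.zero_le _)) (by linarith)

/-! #### The choice of `K` -/

/-- **The choice of `K`** (Aizenman–Duminil-Copin 2021, proof of Thm 1.3 in §6.1: "we may choose
`K ≥ c log B_L(β)` with `2ℓ_K ≤ L`"): for every `N` there is an alive index `K` with `ℓ_K ≤ N` and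
`B_N < D B_{ℓ_K}` — take `K` maximal among the alive indices with `ℓ_K ≤ N`; either the sequence
ends at `K`, or `ℓ_{K+1} > N` and minimality applies. (With `N = ⌊L/2⌋`: `2ℓ_K ≤ L`.)
[cite: AizenmanDuminilCopinAnnals2021, arXiv:1912.07973 §6.1, proof of Theorem 1.3 (p. 21)] -/
theorem exists_bubbleScaleAlive_le_and_lt (hB : Monotone B) (hB0 : 0 < B 0) (hD : 1 < D) (N : ℕ) :
    ∃ K, BubbleScaleAlive B D K ∧ bubbleScale B D K ≤ N ∧ B N < D * B (bubbleScale B D K) := by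
  classical
  set P : ℕ → Prop := fun k => BubbleScaleAlive B D k ∧ bubbleScale B D k ≤ N with hP
  have hP0 : P 0 := ⟨bubbleScaleAlive_zero, by simp⟩
  set K := Nat.findGreatest P N with hK
  have hPK : P K := Nat.findGreatest_spec (Nat.zero_le N) hP0
  refine ⟨K, hPK.1, hPK.2, ?_⟩
  by_contra hge
  have hge' : D * B (bubbleScale B D K) ≤ B N := not_lt.1 hge
  have hex : ∃ n, D * B (bubbleScale B D K) ≤ B n := ⟨N, hge'⟩
  have halive : BubbleScaleAlive B D (K + 1) := bubbleScaleAlive_succ_iff.2 ⟨hPK.1, hex⟩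
  have hle : bubbleScale B D (K + 1) ≤ N := by
    by_contra hlt
    exact absurd hge' (not_le.2 (apply_lt_of_lt_bubbleScale_succ hex (not_le.1 hlt)))
  have hK1 : K + 1 ≤ N := (le_bubbleScale_self hB hB0 hD halive).trans hle
  have := Nat.le_findGreatest (P := P) hK1 ⟨halive, hle⟩
  omega

/-- **The choice of `K`, quantitative form**: with the one-step bound `B_{n+1} ≤ B_n + C₀`, for every
`N` there is an alive `K` with `ℓ_K ≤ N` and `B_N < (B_0 + C₀/(D-1)) D^{K+1}`, i.e.
`K + 1 > (log B_N - log(B_0 + C₀/(D-1)))/log D` ("`K ≥ c log B_L(β)`").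
[cite: AizenmanDuminilCopinAnnals2021, arXiv:1912.07973 §6.1, proof of Theorem 1.3 (p. 21)] -/
theorem exists_bubbleScaleAlive_le_and_lt_pow (hB : Monotone B) (hB0 : 0 < B 0) (hD : 1 < D)
    {C₀ : ℝ} (hstep : ∀ n, B (n + 1) ≤ B n + C₀) (N : ℕ) :
    ∃ K, BubbleScaleAlive B D K ∧ bubbleScale B D K ≤ N ∧ B N < D * B (bubbleScale B D K) ∧
      B N < (B 0 + C₀ / (D - 1)) * D ^ (K + 1) := by
  obtain ⟨K, hK, hle, hlt⟩ := exists_bubbleScaleAlive_le_and_lt hB hB0 hD N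
  refine ⟨K, hK, hle, hlt, lt_of_lt_of_le hlt ?_⟩
  calc D * B (bubbleScale B D K) ≤ D * ((B 0 + C₀ / (D - 1)) * D ^ K) :=
        mul_le_mul_of_nonneg_left (apply_bubbleScale_le hB hB0 hD hstep K) (by linarith)
    _ = (B 0 + C₀ / (D - 1)) * D ^ (K + 1) := by ring

/-- The logarithmic reading of the choice of `K`: if `0 < B_N < C D^{K+1}` with `C > 0`, `D > 1`,
then `log B_N < log C + (K+1) log D`. [folklore] -/
theorem log_lt_of_lt_mul_pow {x C : ℝ} (hx : 0 < x) (hC : 0 < C) (hD : 1 < D) {K : ℕ}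
    (h : x < C * D ^ (K + 1)) : Real.log x < Real.log C + (K + 1) * Real.log D := by
  have hD0 : 0 < D := by linarith
  have := Real.log_lt_log hx h
  rwa [Real.log_mul hC.ne' (pow_pos hD0 _).ne', Real.log_pow, Nat.cast_add, Nat.cast_one] at this

end Abstract

/-! ### Part 2. Extending an initial segment to a doubling sequence -/

section Doubling

/-- **Doubling extension** of the initial segment `ℓ_0, …, ℓ_K`: `ℓ_k` for `k ≤ K` and
`2^{k-K} max(1, ℓ_K)` beyond. Used to feed a finite alive segment of the dynamical scales to
statements quantified over all indices (the annular covering lemma), which only ever look at the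
indices `≤ K`. [folklore] -/
def doublingExt (ℓ : ℕ → ℕ) (K : ℕ) (k : ℕ) : ℕ :=
  if k ≤ K then ℓ k else 2 ^ (k - K) * max 1 (ℓ K)

/-- The extension agrees with `ℓ` up to `K`. [folklore] -/
theorem doublingExt_of_le {ℓ : ℕ → ℕ} {K k : ℕ} (h : k ≤ K) : doublingExt ℓ K k = ℓ k := if_pos h

/-- The extension beyond `K`. [folklore] -/
theorem doublingExt_of_lt {ℓ : ℕ → ℕ} {K k : ℕ} (h : K < k) :
    doublingExt ℓ K k = 2 ^ (k - K) * max 1 (ℓ K) := if_neg (not_le.2 h)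

/-- **The extension doubles**: if `2ℓ_k ≤ ℓ_{k+1}` for `k < K` then `2ℓ'_k ≤ ℓ'_{k+1}` for all `k`.
[folklore] -/
theorem two_mul_doublingExt_le {ℓ : ℕ → ℕ} {K : ℕ} (h2 : ∀ k, k < K → 2 * ℓ k ≤ ℓ (k + 1)) (k : ℕ) :
    2 * doublingExt ℓ K k ≤ doublingExt ℓ K (k + 1) := by
  rcases lt_trichotomy (k + 1) K with hlt | heq | hgt
  · rw [doublingExt_of_le (by omega), doublingExt_of_le hlt.le]
    exact h2 k (by omega)
  · rw [doublingExt_of_le (by omega), doublingExt_of_le heq.le]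
    exact h2 k (by omega)
  · by_cases hk : k ≤ K
    · have hkK : k = K := by omega
      subst hkK
      have h1 : k + 1 - k = 1 := by omega
      rw [doublingExt_of_le le_rfl, doublingExt_of_lt (by omega : k < k + 1), h1, pow_one]
      exact Nat.mul_le_mul_left 2 (le_max_right _ _)
    · rw [doublingExt_of_lt (by omega), doublingExt_of_lt (by omega),
        show k + 1 - K = (k - K) + 1 by omega, pow_succ]
      exact le_of_eq (by ring)

/-- `ℓ'_1 ≥ 1` as soon as `ℓ_1 ≥ 1` whenever `K ≥ 1`. [folklore] -/
theorem one_le_doublingExt_one {ℓ : ℕ → ℕ} {K : ℕ} (h1 : 1 ≤ K → 1 ≤ ℓ 1) :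
    1 ≤ doublingExt ℓ K 1 := by
  by_cases hK : 1 ≤ K
  · rw [doublingExt_of_le hK]; exact h1 hK
  · have hK0 : K = 0 := by omega
    subst hK0
    rw [doublingExt_of_lt Nat.zero_lt_one]
    have : 1 ≤ max 1 (ℓ 0) := le_max_left _ _
    omega

variable {α : Type*} [PseudoMetricSpace α]

/-- Occupation of the annuli of index `k` with `k + 1 ≤ K` is unchanged by the extension. [folklore] -/
theorem annulusOccupied_doublingExt_iff {ℓ : ℕ → ℕ} {K k : ℕ} (hk : k + 1 ≤ K) (X : Finset α) (u : α) :
    AnnulusOccupied (doublingExt ℓ K) X u k ↔ AnnulusOccupied ℓ X u k := by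
  unfold AnnulusOccupied
  rw [doublingExt_of_le (by omega), doublingExt_of_le hk]

/-- **The annulus count up to `K_s` is unchanged** by the extension when `K_s + 1 ≤ K`. [folklore] -/
theorem annulusCount_doublingExt {ℓ : ℕ → ℕ} {K Ks : ℕ} (h : Ks + 1 ≤ K) (X : Finset α) (u : α) :
    annulusCount (doublingExt ℓ K) Ks X u = annulusCount ℓ Ks X u := by
  classical
  unfold annulusCount
  congr 1
  refine Finset.filter_congr fun k hk => ?_
  rw [Finset.mem_range] at hk
  convert annulusOccupied_doublingExt_iff (ℓ := ℓ) (by omega : k + 1 ≤ K) X u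

end Doubling

/-! ### Part 3. The bubble diagram of an infrared-bounded two-point function on `ℤ⁴` -/

section Bubble

variable {S : Site 4 → ℝ} {A : ℝ}

/-- `B_0 = S(0)² = 1` when `S(0) = 1`. [folklore] -/
theorem bubbleDiagram_nat_zero (hS0 : S 0 = 1) : bubbleDiagram S ((0 : ℕ) : ℝ) = 1 := by
  rw [bubbleDiagram_natCast, sum_box_zero (fun v => S v ^ 2), hS0, one_pow]

/-- `n ↦ B_n` is non-decreasing. [folklore] -/
theorem bubbleDiagram_nat_monotone (S : Site 4 → ℝ) : Monotone fun n : ℕ => bubbleDiagram S n :=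
  fun _ _ h => bubbleDiagram_mono S (Nat.cast_le.2 h)

/-- **One shell of the bubble diagram under the infrared bound**: if `0 ≤ S(x) ≤ A/‖x‖²_∞` off the
origin then `∑_{∂Λ_m} S² ≤ 216 A²/m` for `m ≥ 1` (`|∂Λ_m| ≤ 216 m³`). [cite: AizenmanDuminilCopinAnnals2021, arXiv:1912.07973 §6.1, "By the Infrared Bound (5.1), B_L − B_ℓ ≤ C₀ log(L/ℓ)" (p. 21)] -/
theorem sum_sphere_sq_le (h0 : ∀ x, 0 ≤ S x)
    (hIR : ∀ x : Site 4, x ≠ 0 → S x ≤ A / (Site.supNorm x : ℝ) ^ 2) {m : ℕ} (hm : 1 ≤ m) :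
    ∑ x ∈ sphere 4 m, S x ^ 2 ≤ 216 * A ^ 2 / m := by
  have hm0 : (0 : ℝ) < m := by exact_mod_cast hm
  -- `|∂Λ_m| ≤ 216 m³` (as in `card_sphere_four_le`, `ImprovedTreeDiagramBoundSum.lean`)
  have hcard : (#(sphere 4 m) : ℝ) ≤ 216 * (m : ℝ) ^ 3 := by
    obtain ⟨k, rfl⟩ := Nat.exists_eq_succ_of_ne_zero (by omega : m ≠ 0)
    calc (#(sphere 4 (k + 1)) : ℝ) ≤ 2 * (4 : ℕ) * (2 * k + 3 : ℝ) ^ (4 - 1) := card_sphere_succ_le k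
      _ ≤ 216 * ((k + 1 : ℕ) : ℝ) ^ 3 := by
          push_cast
          nlinarith [sq_nonneg (k : ℝ), (by positivity : (0 : ℝ) ≤ k)]
  have hpt : ∀ x ∈ sphere 4 m, S x ^ 2 ≤ A ^ 2 / (m : ℝ) ^ 4 := by
    intro x hx
    have hxn : Site.supNorm x = m := mem_sphere.1 hx
    have hx0 : x ≠ 0 := by
      intro h
      rw [h, Site.supNorm_eq_zero_iff.2 rfl] at hxn
      omega
    have h1 := hIR x hx0
    rw [hxn] at h1
    have hA : 0 ≤ A / (m : ℝ) ^ 2 := le_trans (h0 x) h1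
    calc S x ^ 2 ≤ (A / (m : ℝ) ^ 2) ^ 2 := pow_le_pow_left₀ (h0 x) h1 2
      _ = A ^ 2 / (m : ℝ) ^ 4 := by rw [div_pow]; ring
  calc ∑ x ∈ sphere 4 m, S x ^ 2 ≤ ∑ _x ∈ sphere 4 m, A ^ 2 / (m : ℝ) ^ 4 := Finset.sum_le_sum hpt
    _ = (#(sphere 4 m) : ℝ) * (A ^ 2 / (m : ℝ) ^ 4) := by rw [sum_const, nsmul_eq_mul]
    _ ≤ 216 * (m : ℝ) ^ 3 * (A ^ 2 / (m : ℝ) ^ 4) :=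
        mul_le_mul_of_nonneg_right hcard (by positivity)
    _ = 216 * A ^ 2 / m := by field_simp

/-- **One-step bound** `B_{n+1} ≤ B_n + 216 A²` under the infrared bound `0 ≤ S ≤ A/‖x‖²_∞` off `0`.
[cite: AizenmanDuminilCopinAnnals2021, arXiv:1912.07973 §6.1 (p. 21), via the infrared bound (5.1)] -/
theorem bubbleDiagram_succ_le_add (h0 : ∀ x, 0 ≤ S x)
    (hIR : ∀ x : Site 4, x ≠ 0 → S x ≤ A / (Site.supNorm x : ℝ) ^ 2) (n : ℕ) :
    bubbleDiagram S ((n + 1 : ℕ) : ℝ) ≤ bubbleDiagram S (n : ℕ) + 216 * A ^ 2 := by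
  have h := bubbleDiagram_sub_nat S (Nat.le_succ n)
  rw [← sphere_succ_eq_sdiff] at h
  have hs := sum_sphere_sq_le h0 hIR (m := n + 1) (by omega)
  have hdiv : 216 * A ^ 2 / ((n + 1 : ℕ) : ℝ) ≤ 216 * A ^ 2 := by
    refine div_le_self (by positivity) ?_
    exact_mod_cast Nat.le_add_left 1 n
  linarith

/-- **Dyadic shell bound** `B_{2n} ≤ B_n + 216 A²` under the infrared bound (the `n` shells between
`n` and `2n` each contribute at most `216A²/(n+1)`). [cite: AizenmanDuminilCopinAnnals2021, arXiv:1912.07973 §6.1 (p. 21), via the infrared bound (5.1)] -/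
theorem bubbleDiagram_two_mul_le_add (h0 : ∀ x, 0 ≤ S x)
    (hIR : ∀ x : Site 4, x ≠ 0 → S x ≤ A / (Site.supNorm x : ℝ) ^ 2) (n : ℕ) :
    bubbleDiagram S ((2 * n : ℕ) : ℝ) ≤ bubbleDiagram S (n : ℕ) + 216 * A ^ 2 := by
  -- telescope over the shells `n+1, …, n+j`
  have key : ∀ j : ℕ, bubbleDiagram S ((n + j : ℕ) : ℝ) ≤
      bubbleDiagram S (n : ℕ) + (j : ℝ) * (216 * A ^ 2 / ((n : ℝ) + 1)) := by
    intro j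
    induction j with
    | zero => simp
    | succ j ih =>
      show bubbleDiagram S ((n + j + 1 : ℕ) : ℝ) ≤
        bubbleDiagram S (n : ℕ) + ((j + 1 : ℕ) : ℝ) * (216 * A ^ 2 / ((n : ℝ) + 1))
      have hj1 : ((j + 1 : ℕ) : ℝ) = (j : ℝ) + 1 := by push_cast; ring
      rw [hj1]
      have h := bubbleDiagram_sub_nat S (by omega : n + j ≤ n + j + 1)
      rw [← sphere_succ_eq_sdiff] at h
      have hs := sum_sphere_sq_le h0 hIR (m := n + j + 1) (by omega)
      have hmono : 216 * A ^ 2 / ((n + j + 1 : ℕ) : ℝ) ≤ 216 * A ^ 2 / ((n : ℝ) + 1) := by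
        refine div_le_div_of_nonneg_left (by positivity) (by positivity) ?_
        push_cast
        linarith [(Nat.cast_nonneg j : (0 : ℝ) ≤ j)]
      linarith
  have h := key n
  rw [show n + n = 2 * n by ring] at h
  have hb : (n : ℝ) * (216 * A ^ 2 / ((n : ℝ) + 1)) ≤ 216 * A ^ 2 := by
    rw [mul_div_assoc', div_le_iff₀ (by positivity)]
    nlinarith [sq_nonneg A, (Nat.cast_nonneg n : (0 : ℝ) ≤ n)]
  linarith

/-- **The dynamical scales of the bubble diagram on `ℤ⁴`** (Aizenman–Duminil-Copin 2021, §6.1, the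
paragraph defining `𝓛` and the display `D^k ≤ B_{ℓ_k} ≤ CD^k`, packaged): for
`0 ≤ S ≤ A/‖x‖²_∞` off the origin with `S(0) = 1`, `B_n = bubbleDiagram S n`, and any
`D > 1 + 216A²`, the sequence `ℓ = bubbleScale B D` satisfies, for every alive `K`:
`D^k ≤ B_{ℓ_k} ≤ (1 + 216A²/(D-1)) D^k` (`k ≤ K`, the upper bound for all `k`), `ℓ_0 = 0`,
`2ℓ_k < ℓ_{k+1}` for `k < K` (in particular `ℓ_1 ≥ 1` if `K ≥ 1`). [cite: AizenmanDuminilCopinAnnals2021, arXiv:1912.07973 §6.1, definition of 𝓛 and display D^k ≤ B_{ℓ_k} ≤ CD^k (p. 21)] -/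
theorem bubbleDiagram_scales (h0 : ∀ x, 0 ≤ S x) (hS0 : S 0 = 1)
    (hIR : ∀ x : Site 4, x ≠ 0 → S x ≤ A / (Site.supNorm x : ℝ) ^ 2) {D : ℝ} (hD : 1 + 216 * A ^ 2 < D)
    {K : ℕ} (hK : BubbleScaleAlive (fun n : ℕ => bubbleDiagram S n) D K) :
    (∀ k, k ≤ K → D ^ k ≤ bubbleDiagram S (bubbleScale (fun n : ℕ => bubbleDiagram S n) D k : ℕ)) ∧
    (∀ k, bubbleDiagram S (bubbleScale (fun n : ℕ => bubbleDiagram S n) D k : ℕ) ≤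
        (1 + 216 * A ^ 2 / (D - 1)) * D ^ k) ∧
    (∀ k, k < K → 2 * bubbleScale (fun n : ℕ => bubbleDiagram S n) D k <
        bubbleScale (fun n : ℕ => bubbleDiagram S n) D (k + 1)) := by
  set B : ℕ → ℝ := fun n : ℕ => bubbleDiagram S n with hB_def
  have hB : Monotone B := bubbleDiagram_nat_monotone S
  have hB0 : B 0 = 1 := bubbleDiagram_nat_zero hS0
  have hB0' : 0 < B 0 := by rw [hB0]; exact one_pos
  have hD1 : 1 < D := lt_of_le_of_lt (by nlinarith [sq_nonneg A]) hD
  have hstep : ∀ n, B (n + 1) ≤ B n + 216 * A ^ 2 := bubbleDiagram_succ_le_add h0 hIR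
  have hshell : ∀ n, B (2 * n) ≤ B n + 216 * A ^ 2 := bubbleDiagram_two_mul_le_add h0 hIR
  refine ⟨fun k hk => ?_, fun k => ?_, fun k hk => ?_⟩
  · have := pow_mul_le_apply_bubbleScale (B := B) (by linarith) (hK.mono hk)
    rwa [hB0, mul_one] at this
  · have := apply_bubbleScale_le hB hB0' hD1 hstep k
    rwa [hB0] at this
  · refine two_mul_bubbleScale_lt_succ_of_alive hB hD1 hshell ?_ hK hk
    rw [hB0, mul_one]; linarith

/-- **The choice of `K` for the bubble diagram on `ℤ⁴`**: under the same hypotheses, for every `N`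
there is an alive `K` with `ℓ_K ≤ N`, `B_N < D B_{ℓ_K}` and `B_N < (1 + 216A²/(D-1)) D^{K+1}`
(with `N = ⌊L/2⌋`: "`K ≥ c log B_L(β)` with `2ℓ_K ≤ L`"). [cite: AizenmanDuminilCopinAnnals2021, arXiv:1912.07973 §6.1, proof of Theorem 1.3 (p. 21)] -/
theorem bubbleDiagram_exists_index (h0 : ∀ x, 0 ≤ S x) (hS0 : S 0 = 1)
    (hIR : ∀ x : Site 4, x ≠ 0 → S x ≤ A / (Site.supNorm x : ℝ) ^ 2) {D : ℝ} (hD : 1 + 216 * A ^ 2 < D)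
    (N : ℕ) :
    ∃ K, BubbleScaleAlive (fun n : ℕ => bubbleDiagram S n) D K ∧
      bubbleScale (fun n : ℕ => bubbleDiagram S n) D K ≤ N ∧
      bubbleDiagram S (N : ℕ) < D * bubbleDiagram S (bubbleScale (fun n : ℕ => bubbleDiagram S n) D K : ℕ) ∧
      bubbleDiagram S (N : ℕ) < (1 + 216 * A ^ 2 / (D - 1)) * D ^ (K + 1) := by
  set B : ℕ → ℝ := fun n : ℕ => bubbleDiagram S n with hB_def
  have hB : Monotone B := bubbleDiagram_nat_monotone S
  have hB0 : B 0 = 1 := bubbleDiagram_nat_zero hS0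
  have hB0' : 0 < B 0 := by rw [hB0]; exact one_pos
  have hD1 : 1 < D := lt_of_le_of_lt (by nlinarith [sq_nonneg A]) hD
  have hstep : ∀ n, B (n + 1) ≤ B n + 216 * A ^ 2 := bubbleDiagram_succ_le_add h0 hIR
  obtain ⟨K, hK, hle, hlt, hlt'⟩ := exists_bubbleScaleAlive_le_and_lt_pow hB hB0' hD1 hstep N
  refine ⟨K, hK, hle, hlt, ?_⟩
  rwa [hB0] at hlt'

end Bubble

end Literature.Probability.LatticeModels
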